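import Summits.BirchSwinnertonDyer.BirchSwinnertonDyer.Theorems.SylvesterTwoHeegnerIndexCoupledTelescope
import HarnessLib

/-!
# The COUPLED Cassels–Tate telescope at level `p^M`, III: THEOREM K3's "≤" half `∑ N_i ≤ M₀` ON THE
# TREE'S OBJECTS (`H¹(K, X[p^M])`, `selmerGroup`, `selmerLocalKer`, `torsionLocalKer`)

Sequel of `…Theorems.SylvesterTwoHeegnerIndexCoupledTelescopeStep` (§0–§1) and
`…Theorems.SylvesterTwoHeegnerIndexCoupledTelescope` (§2–§3, `sum_le_M₀_of_coupledCasselsTate`).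
Helper toward crux `UpperOffV0HSYPlus` (stmt-BirchSwinnertonDyer-19804), skeleton of record VARIANT M
(406ca288e244d392), OPEN stubs `stub_tailFour` / `stub_tailSeven` (row k-p2; THEOREM K3 / K3* of
MEMO-bsd-cm-two §64–§65).

WHAT THIS FILE DOES (§4).  It instantiates the abstract coupled telescope on the tree's Galois
cohomology exactly as p620148 `SylvesterTwoCoupledDescentAtTwo` §B instantiates the level-one coupled
descent: `V_X = galH1Torsion (X.baseChange K) (p^M)` for a pair `(A, B)` of Weierstrass curves over
`ℚ` and a number field `K`, `Sel_X = selmerGroup`, local conditions `selmerLocalKer` at the places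
`HeightOneSpectrum (𝓞 K) ⊕ InfinitePlace K` (`mem_selmerGroup_iff`), strict conditions
`⨅_{v ∋ ℓ} torsionLocalKer` at the rational Kolyvagin primes `ℓ` (inert in `K`: `ℓ𝒪_K` prime, so
`λ = ℓ𝒪_K` is the unique place above `ℓ`).  The displayed leaves are the abstract file's, rewritten in
this vocabulary: the two FLIPs with multiples (memo (P2)) at the places `v ∋ ℓ`, the Cassels–Tate value
clauses `hCTV_A` / `hCTV_B` (memo (P5)+(P6)+(P2) in order language) for bi-additive pairings `P_A`,
`P_B` on the Selmer groups (the Cassels–Tate pairing pulled back along `Sel_{p^M} → Ш` and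
sesquilinearly refined, memo §59.1 (i) — the rows compose k-ty1's (WRAP-CT) brick on
`AddCommGroup.primaryComponent Ш 2` with that map), the MIXED Čebotarev kernel clause (memo COROLLARY
3.2″) with «vanishing at every `v ∋ ℓ`», exact orders with room, `𝒪`-isotropy, `𝒪`-independence.
MAIN RESULT: `sum_le_M₀_of_coupledLeaves : … → ∑_{0 < i ≤ K₀} N i ≤ M₀` for ANY prime `p`, level
`p^M`, number field `K`, pair `(A, B)`.  Theorem-only (no definition, no named fact); the leaves are
NOT proved here (row k-p2's Euler-system layer at level `2^{2m}`); nothing asserted on 19804; no stub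
closed; no label moves; BSD not claimed for any curve.  Sources: McCallum 1991 (LMS LN 153) §§3–5;
MEMO-bsd-cm-two §57.3, §59.1, §64; line card `Cruxes/UpperOffV0HSYPlus/Lines/cmframe-kolyvagin2.md` v35.
-/

-- every Summits module is named `Summit.<Summit>.<Problem>…`: the duplicated component is by design
set_option linter.dupNamespace false
set_option autoImplicit false

noncomputable section

open scoped Classical

namespace Summit.BirchSwinnertonDyer.BirchSwinnertonDyer.Theorems.SylvesterTwoCoupledTelescope

open Literature.NumberTheory.EllipticCurves Literature.NumberTheory.EllipticCurves.KolyvaginDescent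

/-! ## §4. Instantiation on the tree's `H¹(K, X[p^M])`, Selmer groups and local kernels -/

section Instantiation

universe u

variable {K : Type u} [Field K] [NumberField K] (A B : WeierstrassCurve ℚ)

open WeierstrassCurve NumberField IsDedekindDomain

/-- **THEOREM K3's "≤" half `∑ N_i ≤ M₀` from the coupled leaves, ON THE TREE'S OBJECTS** (the
`p^M`-level analogue of p620148 §B `selmerGroup_eq_bot_and_le_closure_of_coupledLeaves`).  For ANY
prime power level `n = p^M`, number field `K`, predicate `Kol` of rational primes `ℓ` INERT in `K`
(`ℓ𝒪_K` prime), pair `(A, B)` of Weierstrass curves over `ℚ` (memo two's `(E_{3p²}, E_p)`), additive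
operators `w_A`, `w_B` on `H¹(K, A_K[p^M])`, `H¹(K, B_K[p^M])` preserving the Selmer groups (the CM
operator `[ω]`, k-ty1 `JZero.exists_cm_operator_galH1Torsion`), admissible sets `Adm_A`, `Adm_B`,
a bottom class `x ∈ H¹(K, B_K[p^M])` of order `p^M`, coupled classes `c_A` (odd number of Kolyvagin
primes) / `c_B` (even) with `c_B 1 = p^{M₀} x`, bi-additive pairings `P_A`, `P_B` on the Selmer groups
(the Cassels–Tate pairing pulled back along `Sel_{p^M} → Ш`, sesquilinearly refined — memo §59.1 (i),
k-ty1 (WRAP-CT)), and lifts `s_A i` (`i` odd) / `s_B i` (`i` even), `0 < i ≤ K₀`, ASSUME, in the tree's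
vocabulary (`selmerGroup`, `selmerLocalKer` at `HeightOneSpectrum (𝓞 K)` / `InfinitePlace K`,
`torsionLocalKer` at the places `v ∋ ℓ`): the two FLIPs with multiples (memo (P2)), the Cassels–Tate
value clauses `hCTV_A` / `hCTV_B` (memo (P5)+(P6)+(P2) in order language), the MIXED Čebotarev kernel
clause (memo COROLLARY 3.2″), exact orders `p^{N i}` with room `N i + M₀ ≤ M`, `𝒪`-isotropy and
`𝒪`-independence of the lifts (with `x` on `B`).  THEN **`∑_{0 < i ≤ K₀} N i ≤ M₀`**.  Proof: §2–§3 for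
`V_X = galH1Torsion (X.baseChange K) (p^M)`, local conditions `selmerLocalKer` at
`HeightOneSpectrum (𝓞 K) ⊕ InfinitePlace K` (`mem_selmerGroup_iff`), strict conditions
`⨅_{v ∋ ℓ} torsionLocalKer`, `λ = ℓ𝒪_K` the unique place above `ℓ`.  The leaves are NOT proved here
(row k-p2); nothing asserted on 19804; no stub closed; BSD not claimed for any curve.
[cite: McCallumLMS1991, §1 Theorem; Thm. 5.4 (proof), Cor. 5.6] -/
theorem sum_le_M₀_of_coupledLeaves {p : ℕ} (M M₀ : ℕ) {RA RB : Type*} [AddCommGroup RA]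
    [AddCommGroup RB]
    (hMA : ∀ v : galH1Torsion (A.baseChange K) ((p ^ M : ℕ) : ℤ), ((p : ℤ) ^ M) • v = 0)
    (hMB : ∀ v : galH1Torsion (B.baseChange K) ((p ^ M : ℕ) : ℤ), ((p : ℤ) ^ M) • v = 0)
    (Kol : ℕ → Prop) (hKol : ∀ ℓ, Kol ℓ → ℓ.Prime ∧ (Ideal.span {(ℓ : 𝓞 K)}).IsPrime)
    (wA : galH1Torsion (A.baseChange K) ((p ^ M : ℕ) : ℤ) →+
      galH1Torsion (A.baseChange K) ((p ^ M : ℕ) : ℤ))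
    (wB : galH1Torsion (B.baseChange K) ((p ^ M : ℕ) : ℤ) →+
      galH1Torsion (B.baseChange K) ((p ^ M : ℕ) : ℤ))
    (hwSelA : ∀ s ∈ selmerGroup (A.baseChange K) ((p ^ M : ℕ) : ℤ),
      wA s ∈ selmerGroup (A.baseChange K) ((p ^ M : ℕ) : ℤ))
    (hwSelB : ∀ s ∈ selmerGroup (B.baseChange K) ((p ^ M : ℕ) : ℤ),
      wB s ∈ selmerGroup (B.baseChange K) ((p ^ M : ℕ) : ℤ))
    (AdmA : Set (galH1Torsion (A.baseChange K) ((p ^ M : ℕ) : ℤ)))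
    (AdmB : Set (galH1Torsion (B.baseChange K) ((p ^ M : ℕ) : ℤ)))
    {x : galH1Torsion (B.baseChange K) ((p ^ M : ℕ) : ℤ)} (x_ord : ((p : ℤ) ^ (M - 1)) • x ≠ 0)
    (cA : ℕ → galH1Torsion (A.baseChange K) ((p ^ M : ℕ) : ℤ))
    (cB : ℕ → galH1Torsion (B.baseChange K) ((p ^ M : ℕ) : ℤ))
    (c_one : cB 1 = ((p : ℤ) ^ M₀) • x)
    (cA_adm : ∀ n, KolSupp Kol n → Odd n.primeFactors.card → cA n ∈ AdmA)
    (cB_adm : ∀ n, KolSupp Kol n → Even n.primeFactors.card → cB n ∈ AdmB)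
    (flipA : ∀ ℓ m, Kol ℓ → KolSupp Kol (ℓ * m) → Even m.primeFactors.card →
      ∀ v : HeightOneSpectrum (𝓞 K), (ℓ : 𝓞 K) ∈ v.asIdeal → ∀ a : ℕ,
      (((p : ℤ) ^ a) • cA (ℓ * m) ∈
          selmerLocalKer (A.baseChange K) (v.adicCompletion K) ((p ^ M : ℕ) : ℤ) ↔
        ((p : ℤ) ^ a) • cB m ∈
          (B.baseChange K).torsionLocalKer (v.adicCompletion K) ((p ^ M : ℕ) : ℤ)))
    (flipB : ∀ ℓ m, Kol ℓ → KolSupp Kol (ℓ * m) → Odd m.primeFactors.card →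
      ∀ v : HeightOneSpectrum (𝓞 K), (ℓ : 𝓞 K) ∈ v.asIdeal → ∀ a : ℕ,
      (((p : ℤ) ^ a) • cB (ℓ * m) ∈
          selmerLocalKer (B.baseChange K) (v.adicCompletion K) ((p ^ M : ℕ) : ℤ) ↔
        ((p : ℤ) ^ a) • cA m ∈
          (A.baseChange K).torsionLocalKer (v.adicCompletion K) ((p ^ M : ℕ) : ℤ)))
    (PA : selmerGroup (A.baseChange K) ((p ^ M : ℕ) : ℤ) →+
      selmerGroup (A.baseChange K) ((p ^ M : ℕ) : ℤ) →+ RA)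
    (PB : selmerGroup (B.baseChange K) ((p ^ M : ℕ) : ℤ) →+
      selmerGroup (B.baseChange K) ((p ^ M : ℕ) : ℤ) →+ RB)
    (hCTVA : ∀ ℓ m : ℕ, Kol ℓ → KolSupp Kol (ℓ * m) → ¬ ℓ ∣ m → Even m.primeFactors.card →
      ∀ (j N a b : ℕ) (t : galH1Torsion (A.baseChange K) ((p ^ M : ℕ) : ℤ))
      (ht : t ∈ selmerGroup (A.baseChange K) ((p ^ M : ℕ) : ℤ))
      (hz : ((p : ℤ) ^ j) • cA (ℓ * m) ∈ selmerGroup (A.baseChange K) ((p ^ M : ℕ) : ℤ)),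
      ((p : ℤ) ^ N) • t = 0 →
      (∀ q ∈ m.primeFactors, ∀ v : HeightOneSpectrum (𝓞 K), (q : 𝓞 K) ∈ v.asIdeal →
        t ∈ (A.baseChange K).torsionLocalKer (v.adicCompletion K) ((p ^ M : ℕ) : ℤ)) →
      M - M₀ ≤ j → N + M₀ ≤ M → N ≤ j → a + b + 1 = N →
      (∀ v : HeightOneSpectrum (𝓞 K), (ℓ : 𝓞 K) ∈ v.asIdeal → ((p : ℤ) ^ (a + (j - N))) • cB m ∉
        (B.baseChange K).torsionLocalKer (v.adicCompletion K) ((p ^ M : ℕ) : ℤ)) →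
      (∀ v : HeightOneSpectrum (𝓞 K), (ℓ : 𝓞 K) ∈ v.asIdeal → ((p : ℤ) ^ b) • t ∉
        (A.baseChange K).torsionLocalKer (v.adicCompletion K) ((p ^ M : ℕ) : ℤ)) →
      PA ⟨_, hz⟩ ⟨t, ht⟩ ≠ 0)
    (hCTVB : ∀ ℓ m : ℕ, Kol ℓ → KolSupp Kol (ℓ * m) → ¬ ℓ ∣ m → Odd m.primeFactors.card →
      ∀ (j N a b : ℕ) (t : galH1Torsion (B.baseChange K) ((p ^ M : ℕ) : ℤ))
      (ht : t ∈ selmerGroup (B.baseChange K) ((p ^ M : ℕ) : ℤ))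
      (hz : ((p : ℤ) ^ j) • cB (ℓ * m) ∈ selmerGroup (B.baseChange K) ((p ^ M : ℕ) : ℤ)),
      ((p : ℤ) ^ N) • t = 0 →
      (∀ q ∈ m.primeFactors, ∀ v : HeightOneSpectrum (𝓞 K), (q : 𝓞 K) ∈ v.asIdeal →
        t ∈ (B.baseChange K).torsionLocalKer (v.adicCompletion K) ((p ^ M : ℕ) : ℤ)) →
      M - M₀ ≤ j → N + M₀ ≤ M → N ≤ j → a + b + 1 = N →
      (∀ v : HeightOneSpectrum (𝓞 K), (ℓ : 𝓞 K) ∈ v.asIdeal → ((p : ℤ) ^ (a + (j - N))) • cA m ∉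
        (A.baseChange K).torsionLocalKer (v.adicCompletion K) ((p ^ M : ℕ) : ℤ)) →
      (∀ v : HeightOneSpectrum (𝓞 K), (ℓ : 𝓞 K) ∈ v.asIdeal → ((p : ℤ) ^ b) • t ∉
        (B.baseChange K).torsionLocalKer (v.adicCompletion K) ((p ^ M : ℕ) : ℤ)) →
      PB ⟨_, hz⟩ ⟨t, ht⟩ ≠ 0)
    (hCeb : ∀ (TA : Finset (galH1Torsion (A.baseChange K) ((p ^ M : ℕ) : ℤ)))
      (TB : Finset (galH1Torsion (B.baseChange K) ((p ^ M : ℕ) : ℤ)))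
      (gA : galH1Torsion (A.baseChange K) ((p ^ M : ℕ) : ℤ))
      (gB : galH1Torsion (B.baseChange K) ((p ^ M : ℕ) : ℤ)), gA ∈ AdmA → gB ∈ AdmB →
      (↑TA : Set _) ⊆ AdmA → (↑TB : Set _) ⊆ AdmB → ∀ b : ℕ, ∃ ℓ, b < ℓ ∧ Kol ℓ ∧
      (∀ g ∈ AddSubgroup.closure (insert gA (insert (wA gA) ((TA : Set _) ∪ wA '' (TA : Set _)))),
        (∀ v : HeightOneSpectrum (𝓞 K), (ℓ : 𝓞 K) ∈ v.asIdeal →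
          g ∈ (A.baseChange K).torsionLocalKer (v.adicCompletion K) ((p ^ M : ℕ) : ℤ)) ↔
        g ∈ AddSubgroup.closure ((TA : Set _) ∪ wA '' (TA : Set _))) ∧
      (∀ g ∈ AddSubgroup.closure (insert gB (insert (wB gB) ((TB : Set _) ∪ wB '' (TB : Set _)))),
        (∀ v : HeightOneSpectrum (𝓞 K), (ℓ : 𝓞 K) ∈ v.asIdeal →
          g ∈ (B.baseChange K).torsionLocalKer (v.adicCompletion K) ((p ^ M : ℕ) : ℤ)) ↔
        g ∈ AddSubgroup.closure ((TB : Set _) ∪ wB '' (TB : Set _))))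
    (K₀ : ℕ) (sA : ℕ → galH1Torsion (A.baseChange K) ((p ^ M : ℕ) : ℤ))
    (sB : ℕ → galH1Torsion (B.baseChange K) ((p ^ M : ℕ) : ℤ)) (N : ℕ → ℕ)
    (hselA : ∀ i, sA i ∈ selmerGroup (A.baseChange K) ((p ^ M : ℕ) : ℤ))
    (hselB : ∀ i, sB i ∈ selmerGroup (B.baseChange K) ((p ^ M : ℕ) : ℤ))
    (sA_adm : ∀ i, sA i ∈ AdmA) (sB_adm : ∀ i, sB i ∈ AdmB)
    (hNA : ∀ i, Odd i → ((p : ℤ) ^ N i) • sA i = 0) (hNB : ∀ i, Even i → ((p : ℤ) ^ N i) • sB i = 0)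
    (hNA' : ∀ i ∈ Finset.Ioc 0 K₀, Odd i → N i ≠ 0 → ((p : ℤ) ^ (N i - 1)) • sA i ≠ 0)
    (hNB' : ∀ i ∈ Finset.Ioc 0 K₀, Even i → N i ≠ 0 → ((p : ℤ) ^ (N i - 1)) • sB i ≠ 0)
    (hroom : ∀ i ∈ Finset.Ioc 0 K₀, N i + M₀ ≤ M)
    (hisoA : ∀ i i', Odd i → Odd i' →
      PA ⟨sA i, hselA i⟩ ⟨sA i', hselA i'⟩ = 0 ∧ PA ⟨wA (sA i), hwSelA _ (hselA i)⟩ ⟨sA i', hselA i'⟩ = 0)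
    (hisoB : ∀ i i', Even i → Even i' →
      PB ⟨sB i, hselB i⟩ ⟨sB i', hselB i'⟩ = 0 ∧ PB ⟨wB (sB i), hwSelB _ (hselB i)⟩ ⟨sB i', hselB i'⟩ = 0)
    (hindA : ∀ (α β : ℕ → ℤ),
      ∑ j ∈ (Finset.Ioc 0 K₀).filter (fun j ↦ Odd j), (α j • sA j + β j • wA (sA j)) = 0 →
        ∀ j ∈ (Finset.Ioc 0 K₀).filter (fun j ↦ Odd j), α j • sA j + β j • wA (sA j) = 0)
    (hindB : ∀ (b c : ℤ) (α β : ℕ → ℤ),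
      (b • x + c • wB x) +
          ∑ j ∈ (Finset.Ioc 0 K₀).filter (fun j ↦ Even j), (α j • sB j + β j • wB (sB j)) = 0 →
        b • x + c • wB x = 0 ∧
          ∀ j ∈ (Finset.Ioc 0 K₀).filter (fun j ↦ Even j), α j • sB j + β j • wB (sB j) = 0) :
    ∑ i ∈ Finset.Ioc 0 K₀, N i ≤ M₀ := by
  -- the place `λ = ℓ𝒪_K` above a Kolyvagin prime, and its uniqueness
  let place : ∀ ℓ, Kol ℓ → HeightOneSpectrum (𝓞 K) := fun ℓ h ↦
    ⟨Ideal.span {(ℓ : 𝓞 K)}, (hKol ℓ h).2, by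
      rw [Ne, Ideal.span_singleton_eq_bot]
      exact_mod_cast (hKol ℓ h).1.ne_zero⟩
  have mem_place : ∀ ℓ (h : Kol ℓ), (ℓ : 𝓞 K) ∈ (place ℓ h).asIdeal := fun ℓ h ↦
    Ideal.mem_span_singleton_self _
  have mem_iff : ∀ ℓ (h : Kol ℓ) (v : HeightOneSpectrum (𝓞 K)),
      (ℓ : 𝓞 K) ∈ v.asIdeal ↔ v = place ℓ h := by
    intro ℓ h v
    refine ⟨fun hv ↦ ?_, fun hv ↦ hv ▸ mem_place ℓ h⟩
    apply HeightOneSpectrum.ext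
    have hle : (place ℓ h).asIdeal ≤ v.asIdeal := (Ideal.span_singleton_le_iff_mem _).mpr hv
    exact ((Ideal.IsPrime.isMaximal (place ℓ h).isPrime (place ℓ h).ne_bot).eq_of_le
      v.isPrime.ne_top hle).symm
  -- the abstract data: places, local conditions, `λ`, strict conditions
  let Pl := HeightOneSpectrum (𝓞 K) ⊕ InfinitePlace K
  let LocA : Pl → AddSubgroup (galH1Torsion (A.baseChange K) ((p ^ M : ℕ) : ℤ)) :=
    Sum.elim (fun v ↦ selmerLocalKer (A.baseChange K) (v.adicCompletion K) _)
      (fun y ↦ selmerLocalKer (A.baseChange K) y.Completion _)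
  let LocB : Pl → AddSubgroup (galH1Torsion (B.baseChange K) ((p ^ M : ℕ) : ℤ)) :=
    Sum.elim (fun v ↦ selmerLocalKer (B.baseChange K) (v.adicCompletion K) _)
      (fun y ↦ selmerLocalKer (B.baseChange K) y.Completion _)
  let pl : ℕ → Pl := fun ℓ ↦
    if h : Kol ℓ then Sum.inl (place ℓ h) else Sum.inr (Classical.arbitrary _)
  let AA : ℕ → AddSubgroup (galH1Torsion (A.baseChange K) ((p ^ M : ℕ) : ℤ)) := fun ℓ ↦
    ⨅ (v : HeightOneSpectrum (𝓞 K)) (_ : (ℓ : 𝓞 K) ∈ v.asIdeal),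
      (A.baseChange K).torsionLocalKer (v.adicCompletion K) _
  let AB : ℕ → AddSubgroup (galH1Torsion (B.baseChange K) ((p ^ M : ℕ) : ℤ)) := fun ℓ ↦
    ⨅ (v : HeightOneSpectrum (𝓞 K)) (_ : (ℓ : 𝓞 K) ∈ v.asIdeal),
      (B.baseChange K).torsionLocalKer (v.adicCompletion K) _
  have pl_eq : ∀ ℓ (h : Kol ℓ), pl ℓ = Sum.inl (place ℓ h) := fun ℓ h ↦ dif_pos h
  -- membership in `AX ℓ`: at every place containing `ℓ`; for a Kolyvagin prime, at the place `λ`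
  have memAA_iff : ∀ ℓ (s : galH1Torsion (A.baseChange K) ((p ^ M : ℕ) : ℤ)), s ∈ AA ℓ ↔
      ∀ v : HeightOneSpectrum (𝓞 K), (ℓ : 𝓞 K) ∈ v.asIdeal →
        s ∈ (A.baseChange K).torsionLocalKer (v.adicCompletion K) _ := by
    intro ℓ s
    simp only [AA, AddSubgroup.mem_iInf]
  have memAB_iff : ∀ ℓ (s : galH1Torsion (B.baseChange K) ((p ^ M : ℕ) : ℤ)), s ∈ AB ℓ ↔
      ∀ v : HeightOneSpectrum (𝓞 K), (ℓ : 𝓞 K) ∈ v.asIdeal →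
        s ∈ (B.baseChange K).torsionLocalKer (v.adicCompletion K) _ := by
    intro ℓ s
    simp only [AB, AddSubgroup.mem_iInf]
  have memAA : ∀ ℓ (h : Kol ℓ) (s : galH1Torsion (A.baseChange K) ((p ^ M : ℕ) : ℤ)), s ∈ AA ℓ ↔
      s ∈ (A.baseChange K).torsionLocalKer ((place ℓ h).adicCompletion K) _ := by
    intro ℓ h s
    rw [memAA_iff]
    exact ⟨fun H ↦ H _ (mem_place ℓ h), fun H v hv ↦ by rwa [(mem_iff ℓ h v).mp hv]⟩
  have memAB : ∀ ℓ (h : Kol ℓ) (s : galH1Torsion (B.baseChange K) ((p ^ M : ℕ) : ℤ)), s ∈ AB ℓ ↔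
      s ∈ (B.baseChange K).torsionLocalKer ((place ℓ h).adicCompletion K) _ := by
    intro ℓ h s
    rw [memAB_iff]
    exact ⟨fun H ↦ H _ (mem_place ℓ h), fun H v hv ↦ by rwa [(mem_iff ℓ h v).mp hv]⟩
  have mem_selA_iff : ∀ s, s ∈ selmerGroup (A.baseChange K) ((p ^ M : ℕ) : ℤ) ↔ ∀ v, s ∈ LocA v :=
    fun s ↦ by rw [mem_selmerGroup_iff, Sum.forall]; rfl
  have mem_selB_iff : ∀ s, s ∈ selmerGroup (B.baseChange K) ((p ^ M : ℕ) : ℤ) ↔ ∀ v, s ∈ LocB v :=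
    fun s ↦ by rw [mem_selmerGroup_iff, Sum.forall]; rfl
  -- the leaves in the abstract vocabulary
  have flipA' : ∀ ℓ m, Kol ℓ → KolSupp Kol (ℓ * m) → Even m.primeFactors.card → ∀ a : ℕ,
      ((p : ℤ) ^ a) • cA (ℓ * m) ∈ LocA (pl ℓ) ↔ ((p : ℤ) ^ a) • cB m ∈ AB ℓ := by
    intro ℓ m hℓ hs he a
    rw [pl_eq ℓ hℓ, memAB ℓ hℓ]
    exact flipA ℓ m hℓ hs he _ (mem_place ℓ hℓ) a
  have flipB' : ∀ ℓ m, Kol ℓ → KolSupp Kol (ℓ * m) → Odd m.primeFactors.card → ∀ a : ℕ,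
      ((p : ℤ) ^ a) • cB (ℓ * m) ∈ LocB (pl ℓ) ↔ ((p : ℤ) ^ a) • cA m ∈ AA ℓ := by
    intro ℓ m hℓ hs ho a
    rw [pl_eq ℓ hℓ, memAA ℓ hℓ]
    exact flipB ℓ m hℓ hs ho _ (mem_place ℓ hℓ) a
  refine sum_le_M₀_of_coupledCasselsTate (fun ℓ h ↦ (hKol ℓ h).1) (pl := pl) hMA hMB mem_selA_iff
    mem_selB_iff (AA := AA) (AB := AB) wA wB hwSelA hwSelB x_ord c_one cA_adm cB_adm flipA' flipB'
    PA PB ?_ ?_ ?_ K₀ sA sB N hselA hselB sA_adm sB_adm hNA hNB hNA' hNB' hroom hisoA hisoB hindA hindB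
  · -- `hCTV_A`
    intro ℓ m hℓ hs hnd he j N₁ a b t ht hz hN hqA h1 h2 h3 h4 hc htb
    refine hCTVA ℓ m hℓ hs hnd he j N₁ a b t ht hz hN (fun q hq ↦ (memAA_iff q t).mp (hqA q hq))
      h1 h2 h3 h4 (fun v hv hmem ↦ hc ?_) (fun v hv hmem ↦ htb ?_)
    · rw [memAB ℓ hℓ]
      rwa [(mem_iff ℓ hℓ v).mp hv] at hmem
    · rw [memAA ℓ hℓ]
      rwa [(mem_iff ℓ hℓ v).mp hv] at hmem
  · -- `hCTV_B`
    intro ℓ m hℓ hs hnd ho j N₁ a b t ht hz hN hqB h1 h2 h3 h4 hc htb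
    refine hCTVB ℓ m hℓ hs hnd ho j N₁ a b t ht hz hN (fun q hq ↦ (memAB_iff q t).mp (hqB q hq))
      h1 h2 h3 h4 (fun v hv hmem ↦ hc ?_) (fun v hv hmem ↦ htb ?_)
    · rw [memAA ℓ hℓ]
      rwa [(mem_iff ℓ hℓ v).mp hv] at hmem
    · rw [memAB ℓ hℓ]
      rwa [(mem_iff ℓ hℓ v).mp hv] at hmem
  · -- `hCeb`
    intro TA TB gA gB hgA hgB hTA hTB b
    obtain ⟨ℓ, hb, hℓ, hAcl, hBcl⟩ := hCeb TA TB gA gB hgA hgB hTA hTB b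
    refine ⟨ℓ, hb, hℓ, fun g hg ↦ ?_, fun g hg ↦ ?_⟩
    · rw [memAA_iff]
      exact hAcl g hg
    · rw [memAB_iff]
      exact hBcl g hg

end Instantiation

end Summit.BirchSwinnertonDyer.BirchSwinnertonDyer.Theorems.SylvesterTwoCoupledTelescope

end
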